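/-
Copyright: statement-level skeleton of a published paper (lit-balaban cell, Phase-2 proof seat p10, gen 3). No proof claims
beyond what the kernel checks below.
-/
import Mathlib
import Literature.MathematicalPhysics.QuantumFieldTheory.Balaban1983to89.B5
import Literature.MathematicalPhysics.QuantumFieldTheory.Balaban1983to89.B5Prop11Lattice

/-!
# `Balaban1983to89.B5Prop11SettingModel` — T. Bałaban, *Propagators and renormalization transformations for lattice gauge
theories. I*, Commun. Math. Phys. **95** (1984) 17–40 [Balaban1984PropagatorsI] ("B5"): p. 33, **Proposition 1.1
(1.89)–(1.90) — the abstract-carrier transcription `B5.Prop11Printed` INSTANTIATED BY NAME on its lattice model**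

statement-level skeleton of published theorems with citation tags; proofs where landed; nothing here is a claim about
the Yang–Mills mass gap

PDF held: `paper:balaban1984-cmp95-propagators-rt-i` (journal page = PDF page + 16); p. 33 = PDF p. 17 re-read this session
(`lit read … --pages 17`, lines 5–9).

CITATION HEADER (lean-in-tree rule).  Part of the lit-balaban TYPED SKELETON (HOME `run/shared/lean/pub/lit-balaban/`); WHAT IS
REPRODUCED: SKELETON row **B5.Prop1.1** (`HOME/lit-balaban-r02/ROWS-B5.md`, fold owner r02, referee ref-4), whose currency note
reads *"`B5.Prop11Printed` itself is not instantiated by name — the carrier `Setting` bundles Prop 1.2's norms; NOTE for provers: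
instantiate `Setting.l2op` from `B5Prop11Lattice`"*.  This module does exactly that and nothing more.
THE PRINTED TEXT (p. 33 [PDF 17], verbatim): *"Proposition 1.1. The operator G is a symmetric operator on L²(T_η) and
‖GJ‖, ‖∇GJ‖, ‖G∇*J‖, ‖∇G∇*J‖, ‖∇∇GJ‖, ‖G∇*∇*J‖ ≤ γ₀⁻¹‖J‖, (1.89) with a positive constant γ₀ independent of k, T_η, and
depending on d only (if we put a = 1). This implies the bound from below: Δ_a = G⁻¹ ≥ γ₀(Δ + I). (1.90)"*

WHAT IS TYPED AND PROVED.
* `Loc189 n M` — the arguments `J` of (1.89) on the fine torus `T_η = Tor (fine n M)` (`η = 1/n`): (1.89) lists six operators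
  acting on arguments of THREE tensor types (vector fields `J` for `G`, `∇G`, `∇∇G`; `d`-indexed tensor fields for `G∇*`,
  `∇G∇*`; `d × d`-indexed tensor fields for `G∇*∇*`), while the carrier `B5.Setting` has ONE argument type `Loc`; so `Loc` is
  their disjoint union, `locNorm` the `ℓ²` / tensor-`ℓ²` norm `‖J‖` of `B5Prop11Lattice` (dictionary (a)–(b) there), and
  `l2op189 a m J` the `m`-th printed norm of (1.89) for `G = (Δ_a)⁻¹ = (DeltaA n M a)⁻¹` when `J` lies in the summand on
  which the `m`-th operator acts, and `0` on the other two summands, about which (1.89) says nothing (the inequality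
  `0 ≤ γ₀⁻¹‖J‖` that `B5.Prop11Printed` then records there is vacuous: `l2op189_of_not_Applies`, `locNorm_nonneg`).
* `latticeSetting k n M a o : B5.Setting` — the MODEL of the carrier: the Proposition-1.1 fields (`Loc`, `l2Norm`, `l2op`,
  `Vec`, `formΔa A = Re⟨A, Δ_aA⟩`, `formΔI A = Re⟨A, (Δ + I)A⟩`, `Δ = B5Prop11Lower.Lap`) are the typed lattice objects; the
  Proposition-1.2 fields (`Site`, `dist`, `suppIn`, sup / Hölder norms, cut-offs, `e`, `h1`, `e4`, `h2`, `l2loc`) are NOT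
  interpreted here — they are an arbitrary PARAMETER `o : Prop12Fields (Loc189 n M)`, so everything below holds for every
  choice of them; `k` is the printed step label (B5: `n = L^k`; the bounds hold for every `n ≥ 1`).
* `prop11Printed_latticeSetting` — **`B5.Prop11Printed` HOLDS for every family of lattice settings**: any index type `I`, any
  labels `k_i`, any `n_i ≥ 1`, any coarse tori `M_i` (`(M_i)_μ ≥ 1`), any Prop-1.2 fields `o_i`, one fixed `a > 0`; the
  constant is `γ₀ = B5Prop11Lattice.gammaZero d a` (a function of `d` and `a` only — "independent of k, T_η"), the six bounds
  are `B5Prop11Lattice.ineq189_G … ineq189_GdivT2` and (1.90) is `B5Prop11Lattice.ineq190_form`.  Corollaries: the printed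
  indexing `i = (k, T_η)`, `η = L^{-k}` (`prop11Printed_scales`), and `a = 1` (`prop11Printed_latticeSetting_one`, "depending
  on d only (if we put a = 1)").  «G is a symmetric operator» is `B5Prop11Lattice.DeltaA_inv_isHermitian` (not a field of the
  carrier; restated for the model as `latticeSetting_G_symm`).

WHAT IS NOT CLAIMED.  No value of `γ₀` is attributed to the paper.  The Proposition-1.2 half of the carrier is not modelled
(parametric), so nothing here bears on `B5.Prop12Printed`.  The weighted `L²(T_η)` norm of (1.21) vs. the unweighted `ℓ²`
norm: both sides of each inequality of (1.89) carry the same factor `η^{d/2}` (dictionary (a) of `B5Prop11Lattice`), so the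
instance is stated for `ℓ²`.  Nothing here is progress on a summit; value = the abstract transcription `B5.Prop11Printed`
(consumed downstream only as a hypothesis `(h : B5.Prop11Printed fam)`) is inhabited by its intended model, kernel-checked.
-/

namespace Literature.MathematicalPhysics.QuantumFieldTheory.Balaban1983to89.B5Prop11SettingModel

open scoped BigOperators Matrix
open Literature.MathematicalPhysics.QuantumFieldTheory.Balaban1983to89
open Literature.MathematicalPhysics.QuantumFieldTheory.Balaban1983to89.B5Prop11Plancherel
open Literature.MathematicalPhysics.QuantumFieldTheory.Balaban1983to89.B5Prop11Lower
open Literature.MathematicalPhysics.QuantumFieldTheory.Balaban1983to89.B5DeltaA169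
open Literature.MathematicalPhysics.QuantumFieldTheory.Balaban1983to89.B5Prop11Lattice

noncomputable section

variable {d : ℕ}

/-! ## §1 The arguments `J` of (1.89) and their norms -/

section Loc

variable (n : ℕ) [NeZero n] (M : Fin d → ℕ) [∀ μ, NeZero (M μ)]

/-- The arguments `J` of the six norms (1.89) on `T_η = Tor (fine n M)`: a vector field (`vec`, for `‖GJ‖`, `‖∇GJ‖`,
`‖∇∇GJ‖`), a `d`-indexed tensor field `J = (J_ν)_ν` (`ten`, for `‖G∇*J‖`, `‖∇G∇*J‖`), or a `d × d`-indexed tensor field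
`J = (J_{νν′})` (`ten2`, for `‖G∇*∇*J‖`). [cite: Balaban1984PropagatorsI, Prop. 1.1 (1.89) p.33] -/
inductive Loc189 : Type
  | vec (J : Tor (fine n M) × Fin d → ℂ)
  | ten (J : Fin d → (Tor (fine n M) × Fin d → ℂ))
  | ten2 (J : Fin d × Fin d → (Tor (fine n M) × Fin d → ℂ))

variable {n M}

/-- `‖J‖` on the right of (1.89): the `ℓ²` norm of a vector field, the tensor `ℓ²` norm `(Σ_s ‖J_s‖²)^{1/2}` of a tensor
field (`B5Prop11Lattice.l2`, `l2T`). [cite: Balaban1984PropagatorsI, Prop. 1.1 (1.89) p.33] -/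
def locNorm : Loc189 n M → ℝ
  | .vec J => l2 J
  | .ten J => l2T J
  | .ten2 J => l2T J

/-- `0 ≤ ‖J‖`. [cite: Balaban1984PropagatorsI, Prop. 1.1 (1.89) p.33] -/
theorem locNorm_nonneg (J : Loc189 n M) : 0 ≤ locNorm J := by
  cases J with
  | vec J => exact l2_nonneg J
  | ten J => exact l2T_nonneg J
  | ten2 J => exact l2T_nonneg J

variable (n M)

/-- The six norms of (1.89), `m = 0, …, 5` ↔ `‖GJ‖, ‖∇GJ‖, ‖G∇*J‖, ‖∇G∇*J‖, ‖∇∇GJ‖, ‖G∇*∇*J‖`, for `G = (Δ_a)⁻¹ =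
(DeltaA n M a)⁻¹`, `∇ = grad`, `∇∇ = grad2`, `∇* = divT`, `∇*∇* = divT2` (tensor reading (b) of `B5Prop11Lattice`), each on
the summand of `Loc189` on which that operator acts; `0` on the other two summands (no printed content there).
[cite: Balaban1984PropagatorsI, Prop. 1.1 (1.89) p.33] -/
def l2op189 (a : ℝ) (m : Fin 6) : Loc189 n M → ℝ
  | .vec J => (![l2 ((DeltaA n M a)⁻¹ *ᵥ J), l2T (grad n M ((DeltaA n M a)⁻¹ *ᵥ J)), 0, 0,
      l2T (grad2 n M ((DeltaA n M a)⁻¹ *ᵥ J)), 0] : Fin 6 → ℝ) m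
  | .ten J => (![0, 0, l2 ((DeltaA n M a)⁻¹ *ᵥ divT n M J), l2T (grad n M ((DeltaA n M a)⁻¹ *ᵥ divT n M J)), 0, 0] :
      Fin 6 → ℝ) m
  | .ten2 J => (![0, 0, 0, 0, 0, l2 ((DeltaA n M a)⁻¹ *ᵥ divT2 n M J)] : Fin 6 → ℝ) m

variable {n M}

/-- `‖GJ‖` (m = 0). [cite: Balaban1984PropagatorsI, Prop. 1.1 (1.89) p.33] -/
@[simp] theorem l2op189_zero_vec (a : ℝ) (J : Tor (fine n M) × Fin d → ℂ) :
    l2op189 n M a 0 (.vec J) = l2 ((DeltaA n M a)⁻¹ *ᵥ J) := rfl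

/-- `‖∇GJ‖` (m = 1). [cite: Balaban1984PropagatorsI, Prop. 1.1 (1.89) p.33] -/
@[simp] theorem l2op189_one_vec (a : ℝ) (J : Tor (fine n M) × Fin d → ℂ) :
    l2op189 n M a 1 (.vec J) = l2T (grad n M ((DeltaA n M a)⁻¹ *ᵥ J)) := rfl

/-- `‖G∇*J‖` (m = 2). [cite: Balaban1984PropagatorsI, Prop. 1.1 (1.89) p.33] -/
@[simp] theorem l2op189_two_ten (a : ℝ) (J : Fin d → (Tor (fine n M) × Fin d → ℂ)) :
    l2op189 n M a 2 (.ten J) = l2 ((DeltaA n M a)⁻¹ *ᵥ divT n M J) := rfl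

/-- `‖∇G∇*J‖` (m = 3). [cite: Balaban1984PropagatorsI, Prop. 1.1 (1.89) p.33] -/
@[simp] theorem l2op189_three_ten (a : ℝ) (J : Fin d → (Tor (fine n M) × Fin d → ℂ)) :
    l2op189 n M a 3 (.ten J) = l2T (grad n M ((DeltaA n M a)⁻¹ *ᵥ divT n M J)) := rfl

/-- `‖∇∇GJ‖` (m = 4). [cite: Balaban1984PropagatorsI, Prop. 1.1 (1.89) p.33] -/
@[simp] theorem l2op189_four_vec (a : ℝ) (J : Tor (fine n M) × Fin d → ℂ) :
    l2op189 n M a 4 (.vec J) = l2T (grad2 n M ((DeltaA n M a)⁻¹ *ᵥ J)) := rfl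

/-- `‖G∇*∇*J‖` (m = 5). [cite: Balaban1984PropagatorsI, Prop. 1.1 (1.89) p.33] -/
@[simp] theorem l2op189_five_ten2 (a : ℝ) (J : Fin d × Fin d → (Tor (fine n M) × Fin d → ℂ)) :
    l2op189 n M a 5 (.ten2 J) = l2 ((DeltaA n M a)⁻¹ *ᵥ divT2 n M J) := rfl

/-- Which summand the `m`-th operator of (1.89) acts on. [cite: Balaban1984PropagatorsI, Prop. 1.1 (1.89) p.33] -/
def Applies : Fin 6 → Loc189 n M → Prop
  | m, .vec _ => m = 0 ∨ m = 1 ∨ m = 4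
  | m, .ten _ => m = 2 ∨ m = 3
  | m, .ten2 _ => m = 5

/-- Off the summand on which the `m`-th operator acts, `l2op189` is `0` (no printed content).
[cite: Balaban1984PropagatorsI, Prop. 1.1 (1.89) p.33] -/
theorem l2op189_of_not_Applies (a : ℝ) {m : Fin 6} {J : Loc189 n M} (h : ¬ Applies m J) :
    l2op189 n M a m J = 0 := by
  cases J with
  | vec J => fin_cases m <;> simp_all [Applies, l2op189]
  | ten J => fin_cases m <;> simp_all [Applies, l2op189]
  | ten2 J => fin_cases m <;> simp_all [Applies, l2op189]

/-- **(1.89) on the model, all six norms and all arguments at once**: `l2op189 a m J ≤ γ₀⁻¹‖J‖`, `γ₀ = gammaZero d a`,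
for every `n ≥ 1`, every `M`, every `a > 0`. [cite: Balaban1984PropagatorsI, Prop. 1.1 (1.89) p.33 (kernel version for
the typed operators; constant and proof ours, `B5Prop11Lattice.ineq189_*`)] -/
theorem l2op189_le (a : ℝ) (ha : 0 < a) (m : Fin 6) (J : Loc189 n M) :
    l2op189 n M a m J ≤ (gammaZero d a)⁻¹ * locNorm J := by
  have hn : 1 ≤ n := Nat.one_le_iff_ne_zero.mpr (NeZero.ne n)
  have h0 : ∀ J : Loc189 n M, (0 : ℝ) ≤ (gammaZero d a)⁻¹ * locNorm J := fun J =>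
    mul_nonneg (inv_nonneg.mpr (gammaZero_pos d a).le) (locNorm_nonneg J)
  cases J with
  | vec J =>
      fin_cases m
      · exact ineq189_G n hn M a ha J
      · exact ineq189_gradG n hn M a ha J
      · exact h0 (.vec J)
      · exact h0 (.vec J)
      · exact ineq189_grad2G n hn M a ha J
      · exact h0 (.vec J)
  | ten J =>
      fin_cases m
      · exact h0 (.ten J)
      · exact h0 (.ten J)
      · exact ineq189_GdivT n hn M a ha J
      · exact ineq189_gradGdivT n hn M a ha J
      · exact h0 (.ten J)
      · exact h0 (.ten J)
  | ten2 J =>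
      fin_cases m
      · exact h0 (.ten2 J)
      · exact h0 (.ten2 J)
      · exact h0 (.ten2 J)
      · exact h0 (.ten2 J)
      · exact h0 (.ten2 J)
      · exact ineq189_GdivT2 n hn M a ha J

end Loc

/-! ## §2 The model of the carrier `B5.Setting` -/

/-- The Proposition-1.2 half of the carrier `B5.Setting` (sites `y ∈ T₁^{(k)}` and their distance, `supp J ⊂ Δ̃(y′)`, the sup
and Hölder norms `|J|`, `‖J‖_ε`, the cut-offs `ζ` with `‖ζ‖_α + |ζ|`, `|ζ|`, and the quantities bounded in (1.110)–(1.114)),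
over a given argument type `Loc`; NOT interpreted in this module — an arbitrary parameter of the model.
[cite: Balaban1984PropagatorsI, Prop. 1.2 (1.110)–(1.114) pp.35–36] -/
structure Prop12Fields (Loc : Type) where
  Site : Type
  dist : Site → Site → ℝ
  suppIn : Loc → Site → Prop
  supNorm : Loc → ℝ
  holder : ℝ → Loc → ℝ
  Cut : Type
  cutIn : Cut → Site → Prop
  cutH : ℝ → Cut → ℝ
  cutSup : Cut → ℝ
  e : Fin 4 → Loc → Site → ℝ
  h1 : Loc → ℝ → Cut → ℝ
  e4 : Loc → Site → ℝ
  h2 : Loc → ℝ → Cut → ℝ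
  l2loc : Fin 6 → Loc → Cut → ℝ

/-- **The lattice model of the carrier `B5.Setting`** at step label `k`, fine torus `T_η = Tor (fine n M)` (`η = 1/n`), parameter
`a` of `Δ_a`: `Loc = Loc189 n M`, `l2Norm = locNorm`, `l2op = l2op189 n M a` (the six norms of (1.89) for `G = (Δ_a)⁻¹`),
`Vec` = vector fields `A` on `T_η`, `formΔa A = Re⟨A, Δ_aA⟩`, `formΔI A = Re⟨A, (Δ + I)A⟩` (for (1.90)); the Proposition-1.2
fields are the parameter `o`. [cite: Balaban1984PropagatorsI, Prop. 1.1 (1.89)–(1.90) p.33, §1 (1.64)–(1.71) pp.29–33] -/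
def latticeSetting (k : ℕ) (n : ℕ) [NeZero n] (M : Fin d → ℕ) [∀ μ, NeZero (M μ)] (a : ℝ)
    (o : Prop12Fields (Loc189 n M)) : B5.Setting where
  Site := o.Site
  dist := o.dist
  k := k
  Loc := Loc189 n M
  suppIn := o.suppIn
  supNorm := o.supNorm
  l2Norm := locNorm
  holder := o.holder
  Cut := o.Cut
  cutIn := o.cutIn
  cutH := o.cutH
  cutSup := o.cutSup
  l2op := l2op189 n M a
  e := o.e
  h1 := o.h1
  e4 := o.e4
  h2 := o.h2
  l2loc := o.l2loc
  Vec := Tor (fine n M) × Fin d → ℂ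
  formΔa := fun A => (star A ⬝ᵥ (DeltaA n M a *ᵥ A)).re
  formΔI := fun A => (star A ⬝ᵥ ((Lap n M + 1) *ᵥ A)).re

section Model

variable (k : ℕ) (n : ℕ) [NeZero n] (M : Fin d → ℕ) [∀ μ, NeZero (M μ)] (a : ℝ) (o : Prop12Fields (Loc189 n M))

/-- unfolding: the arguments of the model are `Loc189 n M`. [cite: Balaban1984PropagatorsI, Prop. 1.1 (1.89) p.33] -/
@[simp] theorem latticeSetting_Loc : (latticeSetting k n M a o).Loc = Loc189 n M := rfl

/-- unfolding: `l2op` of the model is `l2op189`. [cite: Balaban1984PropagatorsI, Prop. 1.1 (1.89) p.33] -/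
@[simp] theorem latticeSetting_l2op : (latticeSetting k n M a o).l2op = l2op189 n M a := rfl

/-- unfolding: `l2Norm` of the model is `locNorm`. [cite: Balaban1984PropagatorsI, Prop. 1.1 (1.89) p.33] -/
@[simp] theorem latticeSetting_l2Norm : (latticeSetting k n M a o).l2Norm = locNorm := rfl

/-- unfolding: `formΔa A = Re⟨A, Δ_aA⟩`. [cite: Balaban1984PropagatorsI, Prop. 1.1 (1.90) p.33] -/
@[simp] theorem latticeSetting_formΔa (A : Tor (fine n M) × Fin d → ℂ) :
    (latticeSetting k n M a o).formΔa A = (star A ⬝ᵥ (DeltaA n M a *ᵥ A)).re := rfl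

/-- unfolding: `formΔI A = Re⟨A, (Δ + I)A⟩`. [cite: Balaban1984PropagatorsI, Prop. 1.1 (1.90) p.33] -/
@[simp] theorem latticeSetting_formΔI (A : Tor (fine n M) × Fin d → ℂ) :
    (latticeSetting k n M a o).formΔI A = (star A ⬝ᵥ ((Lap n M + 1) *ᵥ A)).re := rfl

/-- «The operator G is a symmetric operator on L²(T_η)» for the model's `G = (Δ_a)⁻¹` (`a > 0`, `n ≥ 1`).
[cite: Balaban1984PropagatorsI, Prop. 1.1 p.33 (proof ours, `B5Prop11Lattice.DeltaA_inv_isHermitian`)] -/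
theorem latticeSetting_G_symm (ha : 0 < a) : ((DeltaA n M a)⁻¹).IsHermitian :=
  DeltaA_inv_isHermitian n (Nat.one_le_iff_ne_zero.mpr (NeZero.ne n)) M a ha

end Model

/-! ## §3 Proposition 1.1 as transcribed (`B5.Prop11Printed`) holds for every family of lattice settings -/

/-- **Proposition 1.1 (B5 p. 33) in the cell's abstract-carrier transcription, ON ITS MODEL**: for any index type `I` and any
family `i ↦ (k_i, n_i ≥ 1, M_i, o_i)` of lattice settings with one fixed `a > 0`, `B5.Prop11Printed` holds — ONE `γ₀ > 0`
(`= gammaZero d a`, depending on `d` and `a` only: "independent of k, T_η") such that for every `i` the six bounds (1.89)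
`l2op m J ≤ γ₀⁻¹‖J‖` hold for all `m`, `J`, and (1.90) `γ₀⟨A, (Δ + I)A⟩ ≤ ⟨A, Δ_aA⟩` holds for all vector fields `A`.
[cite: Balaban1984PropagatorsI, Prop. 1.1 (1.89)–(1.90) p.33 (kernel version for the typed operators; constant and proof
ours, `B5Prop11Lattice.prop11_lattice`)] -/
theorem prop11Printed_latticeSetting {I : Type} (a : ℝ) (ha : 0 < a) (k : I → ℕ) (n : I → ℕ) [∀ i, NeZero (n i)]
    (M : I → Fin d → ℕ) [∀ i μ, NeZero (M i μ)] (o : ∀ i, Prop12Fields (Loc189 (n i) (M i))) :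
    B5.Prop11Printed (fun i => latticeSetting (k i) (n i) (M i) a (o i)) := by
  refine ⟨gammaZero d a, gammaZero_pos d a, fun i => ⟨fun m J => ?_, fun A => ?_⟩⟩
  · exact l2op189_le a ha m J
  · exact ineq190_form (n i) (Nat.one_le_iff_ne_zero.mpr (NeZero.ne (n i))) (M i) a ha A

/-- The printed indexing `i = (k, T_η)`: `η = L^{-k}` (`n = L^k`, `L ≥ 1`), `T_η` the torus over the coarse torus with `M_μ ≥ 1`
unit-lattice sites per direction. [cite: Balaban1984PropagatorsI, Prop. 1.1 (1.89)–(1.90) p.33 (kernel version; constant and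
proof ours)] -/
theorem prop11Printed_scales (L : ℕ) [NeZero L] (a : ℝ) (ha : 0 < a)
    (o : ∀ i : ℕ × (Fin d → ℕ+), Prop12Fields (Loc189 (L ^ i.1) (fun μ => ((i.2 μ : ℕ+) : ℕ)))) :
    B5.Prop11Printed
      (fun i : ℕ × (Fin d → ℕ+) => latticeSetting i.1 (L ^ i.1) (fun μ => ((i.2 μ : ℕ+) : ℕ)) a (o i)) :=
  prop11Printed_latticeSetting a ha (fun i : ℕ × (Fin d → ℕ+) => i.1) (fun i : ℕ × (Fin d → ℕ+) => L ^ i.1)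
    (fun (i : ℕ × (Fin d → ℕ+)) μ => ((i.2 μ : ℕ+) : ℕ)) o

/-- `a = 1`: «with a positive constant γ₀ independent of k, T_η, and depending on d only (if we put a = 1)».
[cite: Balaban1984PropagatorsI, Prop. 1.1 (1.89)–(1.90) p.33 (kernel version; constant and proof ours)] -/
theorem prop11Printed_latticeSetting_one {I : Type} (k : I → ℕ) (n : I → ℕ) [∀ i, NeZero (n i)]
    (M : I → Fin d → ℕ) [∀ i μ, NeZero (M i μ)] (o : ∀ i, Prop12Fields (Loc189 (n i) (M i))) :
    B5.Prop11Printed (fun i => latticeSetting (k i) (n i) (M i) 1 (o i)) :=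
  prop11Printed_latticeSetting 1 one_pos k n M o

/-- The constant is explicit and uniform: with `γ₀ = gammaZero d a` the two clauses of `B5.Prop11Printed` hold at every
lattice setting. [cite: Balaban1984PropagatorsI, Prop. 1.1 (1.89)–(1.90) p.33 (kernel version; constant and proof ours)] -/
theorem prop11Printed_latticeSetting_explicit (k : ℕ) (n : ℕ) [NeZero n] (M : Fin d → ℕ) [∀ μ, NeZero (M μ)]
    (a : ℝ) (ha : 0 < a) (o : Prop12Fields (Loc189 n M)) :
    (∀ (m : Fin 6) (J : (latticeSetting k n M a o).Loc),
        (latticeSetting k n M a o).l2op m J ≤ (gammaZero d a)⁻¹ * (latticeSetting k n M a o).l2Norm J) ∧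
    (∀ A : (latticeSetting k n M a o).Vec,
        gammaZero d a * (latticeSetting k n M a o).formΔI A ≤ (latticeSetting k n M a o).formΔa A) :=
  ⟨fun m J => l2op189_le a ha m J,
   fun A => ineq190_form n (Nat.one_le_iff_ne_zero.mpr (NeZero.ne n)) M a ha A⟩

end

end Literature.MathematicalPhysics.QuantumFieldTheory.Balaban1983to89.B5Prop11SettingModel
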